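import Mathlib.MeasureTheory.Group.Integral
import Mathlib.Analysis.Calculus.Deriv.Shift
import Mathlib.Analysis.Calculus.MeanValue
import Mathlib.Analysis.InnerProductSpace.Calculus
import Mathlib.MeasureTheory.Integral.DominatedConvergence
import Literature.Analysis.FunctionSpaces.TorusCalculus
import HarnessLib

/-!
# Discharged facts: integration by parts on the flat torus; differentiation under `∫_{T^d}`

`Literature.Analysis.FunctionSpaces.TorusCalculus` records the boundary-free integration by
parts identities on `T^d` as named facts (`def … : Prop`). This file proves all of them, so that
users holding `(h : Torus.integral_partialDeriv_eq_zero)` etc. can discharge the hypothesis: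

* `Torus.integral_partialDeriv_eq_zero_holds` — `∫ ∂ᵢ f = 0` (Evans, App. C.2, Thm. 1);
* `Torus.integral_divergence_eq_zero_holds` — `∫ div u = 0` (ibid.);
* `Torus.integral_inner_gradient_eq_neg_integral_mul_divergence_holds` — `∫ ⟪u, ∇θ⟫ = -∫ θ div u`
  (Evans, App. C.2, Thm. 2);
* `Torus.integral_mul_laplacian_comm_holds` — `∫ θ Δφ = ∫ (Δθ) φ` (Evans, App. C.2, Thm. 3 (iii));
* `Torus.integral_inner_laplacian_eq_neg_holds` — `∫ ⟪u, Δu⟫ = -∑ᵢ ∫ ‖∂ᵢu‖²`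
  (Evans, App. C.2, Thm. 3 (i)).

The common source of all of them is `Torus.integral_lineDeriv_eq_zero`: `s ↦ ∫ f(x + s v) dx` is
constant by translation invariance of Haar measure on the compact group `T^d`
(`MeasureTheory.integral_add_right_eq_self`), and its derivative at `s = 0` is `∫ ∂_v f`.
The latter step is an instance of the second group of results proved here, needed by the energy
balance of `TorusFluidGlue`:

* `Torus.hasDerivWithinAt_integral_of_convex` — differentiation under the integral sign over a
  finite measure space *within a convex time set* `S ⊆ ℝ` (one-sided at endpoints), from
  slice-wise `HasDerivWithinAt`, a uniform bound on the time derivatives near `t`, via the mean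
  value inequality on time segments in `S` and dominated convergence
  (`MeasureTheory.tendsto_integral_filter_of_dominated_convergence`); Mathlib's
  `hasDerivAt_integral_of_dominated_loc_of_deriv_le` is the two-sided (`ball`) version only;
* `Torus.IsSmoothSpaceTimeOn.hasDerivWithinAt_integral` — for a jointly smooth field `φ` on
  `S × T^d`, `S` convex, `d/ds ∫ φ(s, x) dx = ∫ ∂ₜφ(t, x) dx` within `S` (the uniform bound comes
  from joint continuity of `fderivWithin` of the space–time lift and compactness of the torus,
  `IsCompact.eventually_forall_of_forall_eventually`), together with smoothness of the slices
  `∂ₜφ(t, ·)` (`Torus.IsSmoothSpaceTimeOn.isSmooth_timeDerivWithin`).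

Also proved (merged from the parallel discharge p4438, whose acceptance had replaced this file by
a 4-declaration version and thereby removed declarations used downstream by
`TorusFluidGlueProofs`; this revision restores the union of both): `Torus.hasDerivAt_comp_add_proj_smul`,
the derivative of `s ↦ f (x + proj (s • v))` at every `s`.

Also proved: the Leibniz rules for `Torus.fderiv`/`Torus.partialDeriv` of `a • b` and `⟪a, b⟫`,
`⟪∇θ, w⟫ = Dθ w`, `Df w = ∑ᵢ wᵢ ∂ᵢf`, `Δf = ∑ᵢ ∂ᵢ∂ᵢf`
(`InnerProductSpace.laplacian_eq_iteratedFDeriv_orthonormalBasis`), and the transport identity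
`∫ Dθ[u] = 0` for divergence-free `u` (`Torus.integral_fderiv_apply_eq_zero_of_isDivFree`), whence
`∫ ⟪(u·∇)u, u⟫ = 0` and `∫ ⟪∇p, u⟫ = 0`.

## References

* L. C. Evans, *Partial Differential Equations*, 2nd ed., GSM 19 (2010), App. C.2, Thms. 1–3
  (Gauss–Green, integration by parts, Green's formulas; on `T^d` the boundary terms are absent).
* L. Grafakos, *Classical Fourier Analysis*, 3rd ed., GTM 249 (2014), §3.1 (calculus on `T^n` via
  periodic functions).
-/

open MeasureTheory Set Topology Filter
open scoped InnerProductSpace ContDiff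

noncomputable section

namespace Literature.Analysis.FunctionSpaces

namespace Torus

/-! ## Differentiation under the integral sign within a convex time set -/

section Parametric

variable {X : Type*} [MeasurableSpace X] {μ : Measure X} [IsFiniteMeasure μ]
variable {E : Type*} [NormedAddCommGroup E] [NormedSpace ℝ E]

/-- Differentiation under the integral sign, one-sided version over a finite measure space: if
`s ↦ F s x` is differentiable within the convex time set `S` with derivative `F' s x`, the
derivatives are uniformly bounded for `s` near `t` within `S`, and the slices are integrable,
then `s ↦ ∫ F s x dμ` has derivative `∫ F' t x dμ` within `S` at `t` (dominated convergence for
the difference quotients, bounded through the mean value inequality along time segments in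
`S`). [folklore] -/
theorem hasDerivWithinAt_integral_of_convex {S : Set ℝ} (hS : Convex ℝ S) {t : ℝ} (ht : t ∈ S)
    {F F' : ℝ → X → E} (hF_int : ∀ s ∈ S, Integrable (F s) μ)
    (hderiv : ∀ s ∈ S, ∀ x, HasDerivWithinAt (F · x) (F' s x) S s) {C : ℝ}
    (hbound : ∀ᶠ s in 𝓝[S] t, ∀ x, ‖F' s x‖ ≤ C) (hF'_meas : AEStronglyMeasurable (F' t) μ) :
    HasDerivWithinAt (fun s => ∫ x, F s x ∂μ) (∫ x, F' t x ∂μ) S t := by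
  rw [hasDerivWithinAt_iff_tendsto_slope]
  have hmem : ∀ᶠ s in 𝓝[S \ {t}] t, s ∈ S :=
    eventually_mem_nhdsWithin.mono fun s hs => hs.1
  have hslope : (fun s => ∫ x, (s - t)⁻¹ • (F s x - F t x) ∂μ) =ᶠ[𝓝[S \ {t}] t]
      slope (fun s => ∫ x, F s x ∂μ) t := by
    filter_upwards [hmem] with s hs
    rw [slope_def_module, integral_smul, integral_sub (hF_int s hs) (hF_int t ht)]
  refine Tendsto.congr' hslope ?_
  refine tendsto_integral_filter_of_dominated_convergence (fun _ => C) ?_ ?_ (integrable_const C) ?_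
  · filter_upwards [hmem] with s hs
    exact (((hF_int s hs).sub (hF_int t ht)).smul (s - t)⁻¹).aestronglyMeasurable
  · -- uniform bound on the difference quotients via the mean value inequality
    obtain ⟨δ, hδ, hδC⟩ : ∃ δ > 0, ∀ s ∈ S, dist s t < δ → ∀ x, ‖F' s x‖ ≤ C := by
      rcases Metric.mem_nhdsWithin_iff.1 hbound with ⟨δ, hδ, h⟩
      exact ⟨δ, hδ, fun s hs hst x => h ⟨hst, hs⟩ x⟩
    have hball : ∀ᶠ s in 𝓝[S \ {t}] t, dist s t < δ :=
      (Metric.tendsto_nhds.1 tendsto_id δ hδ).filter_mono nhdsWithin_le_nhds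
    filter_upwards [hmem, hball] with s hs hsδ
    refine Eventually.of_forall fun x => ?_
    have hconv : Convex ℝ (S ∩ Metric.ball t δ) := hS.inter (convex_ball t δ)
    have hMVT := hconv.norm_image_sub_le_of_norm_hasDerivWithin_le
      (f := (F · x)) (f' := fun τ => F' τ x)
      (fun τ hτ => (hderiv τ hτ.1 x).mono inter_subset_left)
      (fun τ hτ => hδC τ hτ.1 hτ.2 x) ⟨ht, Metric.mem_ball_self hδ⟩ ⟨hs, hsδ⟩
    rcases eq_or_ne s t with rfl | hst
    · simpa using (norm_nonneg _).trans (hδC s hs hsδ x)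
    · rw [norm_smul, norm_inv, ← div_eq_inv_mul, div_le_iff₀ (norm_pos_iff.2 (sub_ne_zero.2 hst))]
      simpa [Real.norm_eq_abs] using hMVT
  · refine Eventually.of_forall fun x => ?_
    have h := hasDerivWithinAt_iff_tendsto_slope.1 (hderiv t ht x)
    have hs : slope (fun s => F s x) t = fun s => (s - t)⁻¹ • (F s x - F t x) :=
      funext fun s => slope_def_module _ _ _
    rwa [hs] at h

end Parametric

/-! ## Time derivatives of jointly smooth space–time fields on `T^d` -/

section SpaceTime

variable {d : Type*} [Fintype d]
variable {F : Type*} [NormedAddCommGroup F] [NormedSpace ℝ F]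

omit [Fintype d] in
/-- The closed unit cube `[0,1]^d ⊂ ℝ^d` is compact. [folklore] -/
theorem isCompact_toLp_image_pi_Icc :
    IsCompact ((WithLp.toLp 2) '' (Set.pi univ fun _ : d => Icc (0 : ℝ) 1) :
      Set (EuclideanSpace ℝ d)) :=
  (isCompact_univ_pi fun _ => isCompact_Icc).image (PiLp.continuous_toLp 2 _)

omit [Fintype d] in
/-- Fundamental-domain representatives lie in the closed unit cube. [folklore] -/
theorem repr_mem_toLp_image_pi_Icc (x : UnitAddTorus d) :
    repr x ∈ ((WithLp.toLp 2) '' (Set.pi univ fun _ : d => Icc (0 : ℝ) 1) :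
      Set (EuclideanSpace ℝ d)) :=
  ⟨fun i => ((AddCircle.equivIco (1 : ℝ) (0 : ℝ) (x i) : ℝ)),
    fun i _ => Ico_subset_Icc_self (repr_apply_mem_Ico x i), rfl⟩

/-- A convex time set with an accumulation point has nonempty interior (it contains a
nondegenerate segment). [folklore] -/
theorem interior_nonempty_of_convex_of_accPt {S : Set ℝ} (hS : Convex ℝ S) {t : ℝ} (ht : t ∈ S)
    (hacc : AccPt t (𝓟 S)) : (interior S).Nonempty := by
  obtain ⟨y, hyt, hyS⟩ := (accPt_iff_frequently.1 hacc).exists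
  rcases lt_or_gt_of_ne hyt with h | h
  · refine ⟨(y + t) / 2, interior_mono (hS.ordConnected.out hyS ht) ?_⟩
    rw [interior_Icc]
    exact ⟨by linarith, by linarith⟩
  · refine ⟨(y + t) / 2, interior_mono (hS.ordConnected.out ht hyS) ?_⟩
    rw [interior_Icc]
    exact ⟨by linarith, by linarith⟩

/-- Time slices of a jointly smooth space–time field are differentiable in time within the time
set, with derivative `Torus.timeDerivWithin`. [folklore] -/
theorem IsSmoothSpaceTimeOn.hasDerivWithinAt_slice {S : Set ℝ} {φ : ℝ → UnitAddTorus d → F}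
    (hφ : IsSmoothSpaceTimeOn S φ) {s : ℝ} (hs : s ∈ S) (x : UnitAddTorus d) :
    HasDerivWithinAt (fun τ => φ τ x) (timeDerivWithin S φ s x) S s := by
  obtain ⟨y, rfl⟩ := proj_surjective x
  have h1 : DifferentiableWithinAt ℝ (stLift φ) (S ×ˢ univ) (s, y) :=
    hφ.differentiableOn (by simp) (s, y) (mk_mem_prod hs (mem_univ _))
  have h2 : DifferentiableWithinAt ℝ (fun τ : ℝ => (τ, y)) S s :=
    differentiableWithinAt_id.prodMk (differentiableWithinAt_const _)
  exact (h1.comp s h2 fun τ hτ => mk_mem_prod hτ (mem_univ _)).hasDerivWithinAt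

/-- On a time set of unique differentiability, the one-sided time derivative of a jointly
smooth field is the space–time derivative of the lift in the direction `(1, 0)`. [folklore] -/
theorem IsSmoothSpaceTimeOn.timeDerivWithin_apply_proj {S : Set ℝ} {φ : ℝ → UnitAddTorus d → F}
    (hφ : IsSmoothSpaceTimeOn S φ) (hS : UniqueDiffOn ℝ S) {s : ℝ} (hs : s ∈ S)
    (y : EuclideanSpace ℝ d) :
    timeDerivWithin S φ s (proj y) = fderivWithin ℝ (stLift φ) (S ×ˢ univ) (s, y) (1, 0) := by
  have h1 : HasFDerivWithinAt (stLift φ) (fderivWithin ℝ (stLift φ) (S ×ˢ univ) (s, y))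
      (S ×ˢ univ) (s, y) :=
    (hφ.differentiableOn (by simp) (s, y) (mk_mem_prod hs (mem_univ _))).hasFDerivWithinAt
  have h2 : HasDerivWithinAt (fun τ : ℝ => (τ, y)) ((1 : ℝ), (0 : EuclideanSpace ℝ d)) S s :=
    (hasDerivWithinAt_id s S).prodMk (hasDerivWithinAt_const s S y)
  exact (h1.comp_hasDerivWithinAt s h2 fun τ hτ => mk_mem_prod hτ (mem_univ _)).derivWithin (hS s hs)

/-- On a time set of unique differentiability, the one-sided time derivative `∂ₜφ(t, ·)` of a
jointly smooth field is a smooth function on the torus for every `t ∈ S`. [folklore] -/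
theorem IsSmoothSpaceTimeOn.isSmooth_timeDerivWithin {S : Set ℝ} {φ : ℝ → UnitAddTorus d → F}
    (hφ : IsSmoothSpaceTimeOn S φ) (hS : UniqueDiffOn ℝ S) {t : ℝ} (ht : t ∈ S) :
    IsSmooth (timeDerivWithin S φ t) := by
  have hU : UniqueDiffOn ℝ (S ×ˢ (univ : Set (EuclideanSpace ℝ d))) := hS.prod uniqueDiffOn_univ
  have hG : ContDiffOn ℝ ∞ (fun z => fderivWithin ℝ (stLift φ) (S ×ˢ univ) z (1, 0))
      (S ×ˢ (univ : Set (EuclideanSpace ℝ d))) :=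
    (hφ.fderivWithin hU le_rfl).clm_apply contDiffOn_const
  have hlift : lift (timeDerivWithin S φ t) =
      (fun z => fderivWithin ℝ (stLift φ) (S ×ˢ univ) z (1, 0)) ∘ fun y => (t, y) := by
    funext y
    exact hφ.timeDerivWithin_apply_proj hS ht y
  unfold IsSmooth
  rw [hlift]
  exact hG.comp_contDiff (contDiff_prodMk_right t) fun y => ⟨ht, mem_univ y⟩

/-- The one-sided time derivatives `∂ₜφ(s, ·)` of a jointly smooth field are uniformly close to
`∂ₜφ(t, ·)` for `s` near `t` within a time set of unique differentiability (compactness of the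
torus, tube lemma). [folklore] -/
theorem IsSmoothSpaceTimeOn.eventually_norm_timeDerivWithin_sub_lt {S : Set ℝ}
    {φ : ℝ → UnitAddTorus d → F} (hφ : IsSmoothSpaceTimeOn S φ) (hS : UniqueDiffOn ℝ S) {t : ℝ}
    (ht : t ∈ S) {ε : ℝ} (hε : 0 < ε) :
    ∀ᶠ s in 𝓝[S] t, ∀ x, ‖timeDerivWithin S φ s x - timeDerivWithin S φ t x‖ < ε := by
  have hU : UniqueDiffOn ℝ (S ×ˢ (univ : Set (EuclideanSpace ℝ d))) := hS.prod uniqueDiffOn_univ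
  set G : ℝ × EuclideanSpace ℝ d → F := fun z => fderivWithin ℝ (stLift φ) (S ×ˢ univ) z (1, 0)
    with hG_def
  have hGc : ContinuousOn G (S ×ˢ univ) :=
    (hφ.continuousOn_fderivWithin hU (by simp)).clm_apply continuousOn_const
  have htube : ∀ᶠ s in 𝓝 t, ∀ y ∈ ((WithLp.toLp 2) '' (Set.pi univ fun _ : d => Icc (0 : ℝ) 1) :
      Set (EuclideanSpace ℝ d)), s ∈ S → ‖G (s, y) - G (t, y)‖ < ε := by
    apply isCompact_toLp_image_pi_Icc.eventually_forall_of_forall_eventually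
    intro y _
    have hε2 : 0 < ε / 2 := half_pos hε
    have h : ∀ᶠ z in 𝓝[S ×ˢ univ] (t, y), dist (G z) (G (t, y)) < ε / 2 :=
      Metric.tendsto_nhds.1 (hGc (t, y) (mk_mem_prod ht (mem_univ y))) _ hε2
    rw [eventually_nhdsWithin_iff] at h
    have h2 : Tendsto (fun z : ℝ × EuclideanSpace ℝ d => ((t, z.2) : ℝ × EuclideanSpace ℝ d))
        (𝓝 (t, y)) (𝓝[S ×ˢ univ] (t, y)) := by
      refine tendsto_nhdsWithin_iff.2 ⟨?_, Eventually.of_forall fun z => mk_mem_prod ht (mem_univ _)⟩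
      exact ((continuous_const.prodMk continuous_snd).tendsto' (t, y) (t, y) rfl)
    have h' : ∀ᶠ z in 𝓝 (t, y), dist (G (t, z.2)) (G (t, y)) < ε / 2 :=
      Metric.tendsto_nhds.1 ((hGc (t, y) (mk_mem_prod ht (mem_univ y))).tendsto.comp h2) _ hε2
    filter_upwards [h, h'] with z hz hz' hzS
    rw [← dist_eq_norm]
    calc dist (G (z.1, z.2)) (G (t, z.2))
        ≤ dist (G z) (G (t, y)) + dist (G (t, z.2)) (G (t, y)) := dist_triangle_right _ _ _
      _ < ε / 2 + ε / 2 := add_lt_add (hz (mk_mem_prod hzS (mem_univ _))) hz'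
      _ = ε := add_halves ε
  rw [eventually_nhdsWithin_iff]
  filter_upwards [htube] with s hs hsS x
  have h1 := hs (repr x) (repr_mem_toLp_image_pi_Icc x) hsS
  rw [← proj_repr x, hφ.timeDerivWithin_apply_proj hS hsS, hφ.timeDerivWithin_apply_proj hS ht]
  exact h1

/-- Differentiation under `∫_{T^d}` within a convex time set: for a jointly smooth field `φ` on
`S × T^d`, `S` convex, `s ↦ ∫ φ(s, x) dx` has one-sided derivative `∫ ∂ₜφ(t, x) dx` within `S`
at every `t ∈ S` (mean value inequality along time segments in `S`, uniform continuity of `∂ₜφ`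
on the compact torus, dominated convergence). [folklore] -/
theorem IsSmoothSpaceTimeOn.hasDerivWithinAt_integral {S : Set ℝ} {φ : ℝ → UnitAddTorus d → F}
    (hφ : IsSmoothSpaceTimeOn S φ) (hS : Convex ℝ S) {t : ℝ} (ht : t ∈ S) :
    HasDerivWithinAt (fun s => ∫ x, φ s x) (∫ x, timeDerivWithin S φ t x) S t := by
  by_cases hacc : AccPt t (𝓟 S)
  swap
  · exact HasFDerivWithinAt.of_not_accPt hacc
  have hU : UniqueDiffOn ℝ S := uniqueDiffOn_convex hS (interior_nonempty_of_convex_of_accPt hS ht hacc)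
  have hcont : Continuous (timeDerivWithin S φ t) := (hφ.isSmooth_timeDerivWithin hU ht).continuous
  obtain ⟨M, hM⟩ : ∃ M, ∀ x, ‖timeDerivWithin S φ t x‖ ≤ M := by
    obtain ⟨M, hM⟩ := isCompact_univ.exists_bound_of_continuousOn hcont.continuousOn
    exact ⟨M, fun x => hM x (mem_univ x)⟩
  have hbound : ∀ᶠ s in 𝓝[S] t, ∀ x, ‖timeDerivWithin S φ s x‖ ≤ M + 1 := by
    filter_upwards [hφ.eventually_norm_timeDerivWithin_sub_lt hU ht one_pos] with s hs x
    calc ‖timeDerivWithin S φ s x‖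
        ≤ ‖timeDerivWithin S φ t x‖ + ‖timeDerivWithin S φ s x - timeDerivWithin S φ t x‖ :=
          norm_le_norm_add_norm_sub' _ _
      _ ≤ M + 1 := add_le_add (hM x) (hs x).le
  exact hasDerivWithinAt_integral_of_convex hS ht (fun s hs => (hφ.isSmooth_slice hs).integrable)
    (fun s hs x => hφ.hasDerivWithinAt_slice hs x) hbound hcont.aestronglyMeasurable

end SpaceTime

/-! ## Integration by parts on the torus -/

section IBP

variable {d : Type*} [Fintype d] [DecidableEq d]
variable {F : Type*} [NormedAddCommGroup F] [NormedSpace ℝ F]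

omit [DecidableEq d] in
/-- Along a line through `x` in direction `v`, a `C¹` function on the torus has derivative
`∂ᵥ f` at every parameter: `d/ds f (x + proj (s • v)) = lineDeriv f (x + proj (s • v)) v`
(re-centre at `s`: `x + proj (s' • v) = (x + proj (s • v)) + proj ((s' - s) • v)`, and the
re-centred lift `liftAt f _` is differentiable; Grafakos, §3.1). [folklore] -/
theorem hasDerivAt_comp_add_proj_smul {f : UnitAddTorus d → F} (hf : IsContDiff 1 f)
    (x : UnitAddTorus d) (v : EuclideanSpace ℝ d) (s : ℝ) :
    HasDerivAt (fun s : ℝ => f (x + proj (s • v))) (lineDeriv f (x + proj (s • v)) v) s := by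
  set y : UnitAddTorus d := x + proj (s • v) with hy
  have hh : (fun s' : ℝ => f (x + proj (s' • v))) = fun s' => f (y + proj ((s' - s) • v)) := by
    funext s'
    rw [hy, add_assoc, ← proj_add, ← add_smul, add_sub_cancel]
  have hdiff : Differentiable ℝ (fun τ : ℝ => f (y + proj (τ • v))) :=
    ((hf.liftAt y).differentiable one_ne_zero).comp (differentiable_id.smul_const v)
  have h0 : HasDerivAt (fun τ : ℝ => f (y + proj (τ • v))) (lineDeriv f y v) (s - s) := by
    rw [sub_self]
    exact hdiff.differentiableAt.hasDerivAt
  rw [hh]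
  exact h0.comp_sub_const s s

omit [DecidableEq d] in
/-- `∫_{T^d} ∂_v f = 0` for smooth `f` and any direction `v`: the translates
`s ↦ ∫ f(x + s v) dx` are constant (translation invariance of Haar measure), and their
derivative at `s = 0` is `∫ ∂_v f` (differentiation under the integral). [folklore] -/
theorem integral_lineDeriv_eq_zero {f : UnitAddTorus d → F} (hf : IsSmooth f)
    (v : EuclideanSpace ℝ d) : ∫ x, lineDeriv f x v = 0 := by
  set φ : ℝ → UnitAddTorus d → F := fun s x => f (x + proj (s • v)) with hφ_def
  have hφ : IsSmoothSpaceTimeOn univ φ := by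
    have h : stLift φ = lift f ∘ fun z : ℝ × EuclideanSpace ℝ d => z.2 + z.1 • v := by
      funext z
      simp [stLift, hφ_def, lift]
    unfold IsSmoothSpaceTimeOn
    rw [h]
    exact (hf.comp (contDiff_snd.add (contDiff_fst.smul contDiff_const))).contDiffOn
  have hderiv := (hφ.hasDerivWithinAt_integral convex_univ (mem_univ 0)).hasDerivAt univ_mem
  have hconst : (fun s => ∫ x, φ s x) = fun _ => ∫ x, f x :=
    funext fun s => integral_add_right_eq_self f _
  rw [hconst] at hderiv
  have htd : (fun x => timeDerivWithin univ φ 0 x) = fun x => lineDeriv f x v := by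
    funext x
    simp [timeDerivWithin, lineDeriv, hφ_def, derivWithin_univ]
  have h := (hasDerivAt_const (0 : ℝ) (∫ x, f x)).unique hderiv
  rw [htd] at h
  exact h.symm

/-- Discharge of the named fact `Torus.integral_partialDeriv_eq_zero`: `∫_{T^d} ∂ᵢ f = 0` for
smooth `f` (Evans, App. C.2, Thm. 1, empty boundary). [cite: Evans2010, App. C.2 Thm. 1] -/
theorem integral_partialDeriv_eq_zero_holds : integral_partialDeriv_eq_zero (d := d) (F := F) :=
  fun hf i => integral_lineDeriv_eq_zero hf (EuclideanSpace.single i 1)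

/-! ### Product rules for directional derivatives on the torus -/

omit [DecidableEq d] in
/-- Inner products of smooth fields are smooth. [folklore] -/
theorem IsSmooth.inner {G : Type*} [NormedAddCommGroup G] [InnerProductSpace ℝ G]
    {a b : UnitAddTorus d → G} (ha : IsSmooth a) (hb : IsSmooth b) :
    IsSmooth (fun y => ⟪a y, b y⟫_ℝ) :=
  ContDiff.inner ℝ ha hb

omit [DecidableEq d] in
/-- Squared norms of smooth fields are smooth. [folklore] -/
theorem IsSmooth.norm_sq {G : Type*} [NormedAddCommGroup G] [InnerProductSpace ℝ G]
    {u : UnitAddTorus d → G} (hu : IsSmooth u) : IsSmooth (fun y => ‖u y‖ ^ 2) :=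
  ContDiff.norm_sq ℝ hu

omit [DecidableEq d] in
/-- Leibniz rule for the torus derivative of a scalar multiple: `D(a • b)(x) w =
a x • Db(x) w + (Da(x) w) • b x` for `C¹` `a`, `b`. [folklore] -/
theorem fderiv_smul_apply {a : UnitAddTorus d → ℝ} {b : UnitAddTorus d → F} (ha : IsContDiff 1 a)
    (hb : IsContDiff 1 b) (x : UnitAddTorus d) (w : EuclideanSpace ℝ d) :
    Torus.fderiv (fun y => a y • b y) x w = a x • Torus.fderiv b x w + Torus.fderiv a x w • b x := by
  have hda : DifferentiableAt ℝ (liftAt a x) 0 :=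
    ((ha.liftAt x).differentiable one_ne_zero).differentiableAt
  have hdb : DifferentiableAt ℝ (liftAt b x) 0 :=
    ((hb.liftAt x).differentiable one_ne_zero).differentiableAt
  have h : liftAt (fun y => a y • b y) x = fun v => liftAt a x v • liftAt b x v := rfl
  rw [Torus.fderiv, h, fderiv_fun_smul hda hdb]
  simp [Torus.fderiv]

omit [DecidableEq d] in
/-- Leibniz rule for the torus derivative of an inner product: `D⟪a, b⟫(x) w =
⟪a x, Db(x) w⟫ + ⟪Da(x) w, b x⟫` for `C¹` `a`, `b`. [folklore] -/
theorem fderiv_inner_apply {G : Type*} [NormedAddCommGroup G] [InnerProductSpace ℝ G]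
    {a b : UnitAddTorus d → G} (ha : IsContDiff 1 a) (hb : IsContDiff 1 b) (x : UnitAddTorus d)
    (w : EuclideanSpace ℝ d) :
    Torus.fderiv (fun y => ⟪a y, b y⟫_ℝ) x w =
      ⟪a x, Torus.fderiv b x w⟫_ℝ + ⟪Torus.fderiv a x w, b x⟫_ℝ := by
  have hda : DifferentiableAt ℝ (liftAt a x) 0 :=
    ((ha.liftAt x).differentiable one_ne_zero).differentiableAt
  have hdb : DifferentiableAt ℝ (liftAt b x) 0 :=
    ((hb.liftAt x).differentiable one_ne_zero).differentiableAt
  have h : liftAt (fun y => ⟪a y, b y⟫_ℝ) x = fun v => ⟪liftAt a x v, liftAt b x v⟫_ℝ := rfl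
  rw [Torus.fderiv, h, _root_.fderiv_inner_apply ℝ hda hdb]
  simp [Torus.fderiv]

omit [DecidableEq d] in
/-- The torus derivative of `‖u‖²`: `D(‖u‖²)(x) w = 2 ⟪u x, Du(x) w⟫`. [folklore] -/
theorem fderiv_norm_sq_apply {G : Type*} [NormedAddCommGroup G] [InnerProductSpace ℝ G]
    {u : UnitAddTorus d → G} (hu : IsContDiff 1 u) (x : UnitAddTorus d) (w : EuclideanSpace ℝ d) :
    Torus.fderiv (fun y => ‖u y‖ ^ 2) x w = 2 * ⟪u x, Torus.fderiv u x w⟫_ℝ := by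
  have h : (fun y => ‖u y‖ ^ 2) = fun y => ⟪u y, u y⟫_ℝ := funext fun y => (real_inner_self_eq_norm_sq _).symm
  rw [h, fderiv_inner_apply hu hu, real_inner_comm (u x)]
  ring

omit [DecidableEq d] in
/-- The gradient represents the derivative: `⟪∇θ(x), w⟫ = Dθ(x) w`. [folklore] -/
theorem inner_gradient_left (θ : UnitAddTorus d → ℝ) (x : UnitAddTorus d) (w : EuclideanSpace ℝ d) :
    ⟪Torus.gradient θ x, w⟫_ℝ = Torus.fderiv θ x w := by
  rw [Torus.gradient, _root_.gradient, InnerProductSpace.toDual_symm_apply]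
  rfl

/-- Expansion of the torus derivative in partial derivatives: `Df(x) w = ∑ᵢ wᵢ • ∂ᵢ f(x)` for
`C¹` `f`. [folklore] -/
theorem fderiv_apply_eq_sum_partialDeriv {f : UnitAddTorus d → F} (hf : IsContDiff 1 f)
    (x : UnitAddTorus d) (w : EuclideanSpace ℝ d) :
    Torus.fderiv f x w = ∑ i, w i • partialDeriv i f x := by
  conv_lhs => rw [← (EuclideanSpace.basisFun d ℝ).sum_repr w]
  simp [map_sum, map_smul, partialDeriv_eq_fderiv_apply hf]

/-- Leibniz rule for partial derivatives of a scalar multiple on the torus. [folklore] -/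
theorem partialDeriv_smul {a : UnitAddTorus d → ℝ} {b : UnitAddTorus d → F} (ha : IsContDiff 1 a)
    (hb : IsContDiff 1 b) (i : d) (x : UnitAddTorus d) :
    partialDeriv i (fun y => a y • b y) x =
      a x • partialDeriv i b x + partialDeriv i a x • b x := by
  have hab : IsContDiff 1 (fun y => a y • b y) := ContDiff.smul ha hb
  rw [partialDeriv_eq_fderiv_apply hab, partialDeriv_eq_fderiv_apply ha,
    partialDeriv_eq_fderiv_apply hb, fderiv_smul_apply ha hb]

/-- Leibniz rule for partial derivatives of an inner product on the torus. [folklore] -/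
theorem partialDeriv_inner {G : Type*} [NormedAddCommGroup G] [InnerProductSpace ℝ G]
    {a b : UnitAddTorus d → G} (ha : IsContDiff 1 a) (hb : IsContDiff 1 b) (i : d)
    (x : UnitAddTorus d) :
    partialDeriv i (fun y => ⟪a y, b y⟫_ℝ) x =
      ⟪a x, partialDeriv i b x⟫_ℝ + ⟪partialDeriv i a x, b x⟫_ℝ := by
  have hab : IsContDiff 1 (fun y => ⟪a y, b y⟫_ℝ) := ContDiff.inner ℝ ha hb
  rw [partialDeriv_eq_fderiv_apply hab, partialDeriv_eq_fderiv_apply ha,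
    partialDeriv_eq_fderiv_apply hb, fderiv_inner_apply ha hb]

/-! ### Transport identity: `∫ Dθ[u] = 0` for divergence-free `u` -/

/-- For a smooth divergence-free vector field `u` and a smooth `θ`,
`Dθ(x)[u(x)] = ∑ᵢ ∂ᵢ (uᵢ θ)(x)` pointwise. [folklore] -/
theorem fderiv_apply_eq_sum_partialDeriv_smul_of_isDivFree {u : UnitAddTorus d → EuclideanSpace ℝ d}
    {θ : UnitAddTorus d → F} (hu : IsSmooth u) (hθ : IsSmooth θ) (hdiv : IsDivFree u)
    (x : UnitAddTorus d) :
    Torus.fderiv θ x (u x) = ∑ i, partialDeriv i (fun y => u y i • θ y) x := by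
  have h1 : ∀ i, IsContDiff 1 (fun y => u y i) := fun i => (hu.apply i).isContDiff (by simp)
  have hθ1 : IsContDiff 1 θ := hθ.isContDiff (by simp)
  simp_rw [partialDeriv_smul (h1 _) hθ1, Finset.sum_add_distrib, ← Finset.sum_smul]
  have hd : ∑ i, partialDeriv i (fun y => u y i) x = 0 := hdiv x
  rw [hd, zero_smul, add_zero, fderiv_apply_eq_sum_partialDeriv hθ1]

/-- Transport identity on the torus: `∫_{T^d} Dθ(x)[u(x)] dx = 0` for a smooth divergence-free
vector field `u` and smooth `θ` (write `Dθ[u] = ∑ᵢ ∂ᵢ(uᵢ θ) - (div u) θ` and integrate by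
parts; Evans, App. C.2, Thm. 2 with empty boundary). In particular the convective term
`∫ ⟪(u·∇)u, u⟫` and the pressure term `∫ ⟪∇p, u⟫` of the energy balance vanish. [folklore] -/
theorem integral_fderiv_apply_eq_zero_of_isDivFree {u : UnitAddTorus d → EuclideanSpace ℝ d}
    {θ : UnitAddTorus d → F} (hu : IsSmooth u) (hθ : IsSmooth θ) (hdiv : IsDivFree u) :
    ∫ x, Torus.fderiv θ x (u x) = 0 := by
  simp_rw [fderiv_apply_eq_sum_partialDeriv_smul_of_isDivFree hu hθ hdiv]
  rw [integral_finsetSum]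
  · exact Finset.sum_eq_zero fun i _ =>
      integral_partialDeriv_eq_zero_holds ((hu.apply i).smul' hθ) i
  · exact fun i _ => (((hu.apply i).smul' hθ).partialDeriv i).integrable

/-- `∫ ⟪(u·∇)u, u⟫ = 0` for a smooth divergence-free field (`⟪(u·∇)u, u⟫ = ½ D‖u‖²[u]`). [folklore] -/
theorem integral_inner_convect_self_eq_zero {u : UnitAddTorus d → EuclideanSpace ℝ d}
    (hu : IsSmooth u) (hdiv : IsDivFree u) : ∫ x, ⟪convect u u x, u x⟫_ℝ = 0 := by
  have h : ∀ x, ⟪convect u u x, u x⟫_ℝ = 2⁻¹ * Torus.fderiv (fun y => ‖u y‖ ^ 2) x (u x) := by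
    intro x
    rw [fderiv_norm_sq_apply (hu.isContDiff (by simp)), convect, real_inner_comm]
    ring
  simp_rw [h, integral_const_mul,
    integral_fderiv_apply_eq_zero_of_isDivFree hu hu.norm_sq hdiv, mul_zero]

/-- `∫ ⟪∇p, u⟫ = 0` for smooth `p` and a smooth divergence-free field `u`. [folklore] -/
theorem integral_inner_gradient_eq_zero_of_isDivFree {u : UnitAddTorus d → EuclideanSpace ℝ d}
    {p : UnitAddTorus d → ℝ} (hu : IsSmooth u) (hp : IsSmooth p) (hdiv : IsDivFree u) :
    ∫ x, ⟪Torus.gradient p x, u x⟫_ℝ = 0 := by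
  simp_rw [inner_gradient_left]
  exact integral_fderiv_apply_eq_zero_of_isDivFree hu hp hdiv

/-! ### The Laplacian as a sum of second partial derivatives, and the energy identity -/

omit [DecidableEq d] in
/-- The re-centred lift of a directional derivative is the directional Fréchet derivative of the
re-centred lift: `liftAt (∂_v f) x = (D(liftAt f x) ·) v`. [folklore] -/
theorem liftAt_lineDeriv {f : UnitAddTorus d → F} (hf : IsContDiff 1 f) (x : UnitAddTorus d)
    (v : EuclideanSpace ℝ d) :
    liftAt (fun y => lineDeriv f y v) x = fun w => _root_.fderiv ℝ (liftAt f x) w v := by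
  funext w
  rw [liftAt_apply, lineDeriv_eq_fderiv_apply hf, Torus.fderiv]
  have h : liftAt f (x + proj w) = fun z => liftAt f x (w + z) := by
    funext z
    simp [add_assoc]
  rw [h, fderiv_comp_add_left, add_zero]

omit [DecidableEq d] in
/-- Second directional derivatives on the torus are second Fréchet derivatives of the lift:
`∂_v ∂_v f (x) = D²(liftAt f x)(0)[v, v]`. [folklore] -/
theorem lineDeriv_lineDeriv_eq_iteratedFDeriv {f : UnitAddTorus d → F} (hf : IsSmooth f)
    (x : UnitAddTorus d) (v : EuclideanSpace ℝ d) :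
    lineDeriv (fun y => lineDeriv f y v) x v = iteratedFDeriv ℝ 2 (liftAt f x) 0 ![v, v] := by
  have hf1 : IsContDiff 1 f := hf.isContDiff (by simp)
  have hg1 : IsContDiff 1 (fun y => lineDeriv f y v) := (hf.lineDeriv v).isContDiff (by simp)
  rw [lineDeriv_eq_fderiv_apply hg1, Torus.fderiv, liftAt_lineDeriv hf1, iteratedFDeriv_two_apply]
  have hc : DifferentiableAt ℝ (_root_.fderiv ℝ (liftAt f x)) 0 :=
    (((hf.liftAt x).fderiv_right (m := ∞) le_rfl).differentiable (by simp)).differentiableAt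
  rw [fderiv_clm_apply hc (differentiableAt_const v)]
  simp

omit [DecidableEq d] in
/-- The torus Laplacian is the sum of pure second directional derivatives along any
orthonormal basis; with the standard basis, `Δf = ∑ᵢ ∂ᵢ∂ᵢ f`. [folklore] -/
theorem laplacian_eq_sum_lineDeriv_lineDeriv {f : UnitAddTorus d → F} (hf : IsSmooth f)
    {ι : Type*} [Fintype ι] (b : OrthonormalBasis ι ℝ (EuclideanSpace ℝ d)) (x : UnitAddTorus d) :
    laplacian f x = ∑ i, lineDeriv (fun y => lineDeriv f y (b i)) x (b i) := by
  rw [Torus.laplacian, InnerProductSpace.laplacian_eq_iteratedFDeriv_orthonormalBasis _ b]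
  simp_rw [lineDeriv_lineDeriv_eq_iteratedFDeriv hf]

/-- `Δf = ∑ᵢ ∂ᵢ∂ᵢ f` for smooth `f` on the torus. [folklore] -/
theorem laplacian_eq_sum_partialDeriv_partialDeriv {f : UnitAddTorus d → F} (hf : IsSmooth f)
    (x : UnitAddTorus d) :
    laplacian f x = ∑ i, partialDeriv i (partialDeriv i f) x := by
  rw [laplacian_eq_sum_lineDeriv_lineDeriv hf (EuclideanSpace.basisFun d ℝ)]
  refine Finset.sum_congr rfl fun i _ => ?_
  simp only [EuclideanSpace.basisFun_apply]
  rfl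

/-- Discharge of the named fact `Torus.integral_inner_laplacian_eq_neg`: the energy identity
`∫ ⟪u, Δu⟫ = -∑ᵢ ∫ ‖∂ᵢu‖²` for smooth fields with values in a real inner product space
(`⟪u, ∂ᵢ∂ᵢu⟫ = ∂ᵢ⟪u, ∂ᵢu⟫ - ‖∂ᵢu‖²` and `∫ ∂ᵢ(·) = 0`; Evans, App. C.2, Thm. 3 (i), empty
boundary). [cite: Evans2010, App. C.2 Thm. 3 (i)] -/
theorem integral_inner_laplacian_eq_neg_holds : integral_inner_laplacian_eq_neg (d := d) := by
  intro G _ _ u hu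
  have h1 : ∀ i, IsContDiff 1 (partialDeriv i u) := fun i => (hu.partialDeriv i).isContDiff (by simp)
  have hu1 : IsContDiff 1 u := hu.isContDiff (by simp)
  have hpt : ∀ x, ⟪u x, laplacian u x⟫_ℝ =
      ∑ i, (partialDeriv i (fun y => ⟪u y, partialDeriv i u y⟫_ℝ) x - ‖partialDeriv i u x‖ ^ 2) := by
    intro x
    rw [laplacian_eq_sum_partialDeriv_partialDeriv hu, inner_sum]
    refine Finset.sum_congr rfl fun i _ => ?_
    rw [partialDeriv_inner hu1 (h1 i), ← real_inner_self_eq_norm_sq]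
    ring
  simp_rw [hpt]
  rw [integral_finsetSum _ fun i _ => ?_, ← Finset.sum_neg_distrib]
  · refine Finset.sum_congr rfl fun i _ => ?_
    rw [integral_sub, integral_partialDeriv_eq_zero_holds (hu.inner (hu.partialDeriv i)) i,
      zero_sub]
    · exact ((hu.inner (hu.partialDeriv i)).partialDeriv i).integrable
    · exact (hu.partialDeriv i).norm_sq.integrable
  · exact ((hu.inner (hu.partialDeriv i)).partialDeriv i).integrable.sub
      (hu.partialDeriv i).norm_sq.integrable

/-! ### The remaining integration-by-parts facts of `TorusCalculus` -/

/-- Leibniz rule for partial derivatives of a product of scalar functions on the torus. [folklore] -/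
theorem partialDeriv_mul {a b : UnitAddTorus d → ℝ} (ha : IsContDiff 1 a) (hb : IsContDiff 1 b)
    (i : d) (x : UnitAddTorus d) :
    partialDeriv i (fun y => a y * b y) x = a x * partialDeriv i b x + partialDeriv i a x * b x :=
  partialDeriv_smul ha hb i x

/-- Discharge of the named fact `Torus.integral_divergence_eq_zero`: `∫_{T^d} div u = 0` for
smooth `u` (Evans, App. C.2, Thm. 1, empty boundary). [cite: Evans2010, App. C.2 Thm. 1] -/
theorem integral_divergence_eq_zero_holds : integral_divergence_eq_zero (d := d) := by
  intro u hu
  simp only [divergence]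
  rw [integral_finsetSum _ fun i _ => ((hu.apply i).partialDeriv i).integrable]
  exact Finset.sum_eq_zero fun i _ => integral_partialDeriv_eq_zero_holds (hu.apply i) i

/-- Discharge of the named fact `Torus.integral_inner_gradient_eq_neg_integral_mul_divergence`:
`∫ ⟪u, ∇θ⟫ = -∫ θ div u` for smooth `u`, `θ` (`⟪u, ∇θ⟫ + θ div u = ∑ᵢ ∂ᵢ(uᵢ θ)`; Evans,
App. C.2, Thm. 2, empty boundary). [cite: Evans2010, App. C.2 Thm. 2] -/
theorem integral_inner_gradient_eq_neg_integral_mul_divergence_holds :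
    integral_inner_gradient_eq_neg_integral_mul_divergence (d := d) := by
  intro u θ hu hθ
  have h1 : ∀ i, IsContDiff 1 (fun y => u y i) := fun i => (hu.apply i).isContDiff (by simp)
  have hθ1 : IsContDiff 1 θ := hθ.isContDiff (by simp)
  have hpt : ∀ x, ⟪u x, gradient θ x⟫_ℝ =
      ∑ i, partialDeriv i (fun y => u y i • θ y) x - θ x * divergence u x := by
    intro x
    rw [real_inner_comm, inner_gradient_left, fderiv_apply_eq_sum_partialDeriv hθ1, divergence,
      Finset.mul_sum, ← Finset.sum_sub_distrib]
    refine Finset.sum_congr rfl fun i _ => ?_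
    rw [partialDeriv_smul (h1 i) hθ1]
    simp only [smul_eq_mul]
    ring
  simp_rw [hpt]
  rw [integral_sub, integral_finsetSum, Finset.sum_eq_zero
      fun i _ => integral_partialDeriv_eq_zero_holds ((hu.apply i).smul' hθ) i, zero_sub]
  · exact fun i _ => (((hu.apply i).smul' hθ).partialDeriv i).integrable
  · exact (integrable_finsetSum _ fun i _ => (((hu.apply i).smul' hθ).partialDeriv i).integrable)
  · exact (hθ.smul' hu.divergence).integrable

/-- Green's first identity on the torus for scalar functions: `∫ a Δb = -∑ᵢ ∫ ∂ᵢa ∂ᵢb` for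
smooth `a`, `b` (Evans, App. C.2, Thm. 3 (i)/(ii), empty boundary). [folklore] -/
theorem integral_mul_laplacian_eq_neg_sum {a b : UnitAddTorus d → ℝ} (ha : IsSmooth a)
    (hb : IsSmooth b) :
    ∫ x, a x * laplacian b x = -∑ i, ∫ x, partialDeriv i a x * partialDeriv i b x := by
  have ha1 : IsContDiff 1 a := ha.isContDiff (by simp)
  have hb1 : ∀ i, IsContDiff 1 (partialDeriv i b) := fun i => (hb.partialDeriv i).isContDiff (by simp)
  have hpt : ∀ x, a x * laplacian b x = ∑ i, (partialDeriv i (fun y => a y * partialDeriv i b y) x -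
      partialDeriv i a x * partialDeriv i b x) := by
    intro x
    rw [laplacian_eq_sum_partialDeriv_partialDeriv hb, Finset.mul_sum]
    refine Finset.sum_congr rfl fun i _ => ?_
    rw [partialDeriv_mul ha1 (hb1 i)]
    ring
  have hs : ∀ i, IsSmooth (fun y => a y * partialDeriv i b y) := fun i =>
    (ContDiff.mul ha (hb.partialDeriv i) : IsSmooth fun y => a y * partialDeriv i b y)
  have hp : ∀ i, IsSmooth (fun y => partialDeriv i a y * partialDeriv i b y) := fun i =>
    (ContDiff.mul (ha.partialDeriv i) (hb.partialDeriv i) :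
      IsSmooth fun y => partialDeriv i a y * partialDeriv i b y)
  simp_rw [hpt]
  rw [integral_finsetSum _ fun i _ => ?_, ← Finset.sum_neg_distrib]
  · refine Finset.sum_congr rfl fun i _ => ?_
    rw [integral_sub ((hs i).partialDeriv i).integrable (hp i).integrable,
      integral_partialDeriv_eq_zero_holds (hs i) i, zero_sub]
  · exact ((hs i).partialDeriv i).integrable.sub (hp i).integrable

/-- Discharge of the named fact `Torus.integral_mul_laplacian_comm`: Green's second identity
`∫ θ Δφ = ∫ (Δθ) φ` on the torus (both sides equal `-∑ᵢ ∫ ∂ᵢθ ∂ᵢφ`; Evans, App. C.2,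
Thm. 3 (iii), empty boundary). [cite: Evans2010, App. C.2 Thm. 3 (iii)] -/
theorem integral_mul_laplacian_comm_holds : integral_mul_laplacian_comm (d := d) := by
  intro θ φ hθ hφ
  have h : (fun x => laplacian θ x * φ x) = fun x => φ x * laplacian θ x := funext fun x => mul_comm _ _
  rw [h, integral_mul_laplacian_eq_neg_sum hθ hφ, integral_mul_laplacian_eq_neg_sum hφ hθ]
  simp_rw [mul_comm (partialDeriv _ φ _)]

end IBP

end Torus

end Literature.Analysis.FunctionSpaces
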